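import Summits.QuantumAdvantage.QuantumAdvantage.Theorems.InnerDegreeLawsH

set_option linter.dupNamespace false

/-!
# InnerDegreeLawsI (lens 4, g27; part I = LAND-PACKAGE-6) — ROW LABELS ARE FREE: the saturated bound rank ≥ p^r persists for row-dependent non-constant tables (row-by-row Fourier inversion, one nonzero frequency per line representative), with the column-side affine label and change of pairing; the row-table saturated rectangle kill absorbs every row-side label of the dense register

Blocker `X = AbsorptionDial.NoPerfectPolyOdd` (item 28487); decomp-qadv lens 4 (minimal-counterexample / extremal reduction), g27.  The NODE record
(rung `QuadFormNoPerfectOdd`, residual `QuadLiftOdd`, sub-rung `OneQuadNoPerfectOdd`, floor `linFormFloor`, `x_iff_pieces`) lives in the cell file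
`g27/InnerDegreeDial.lean` and is NOT landed (Prop-definition node pieces); the tree parts are Prop-definition-free and state only unconditional LAWS.
Parts A–H are LANDED (p825604/p825613/p825616/p825666/p826280/p826399/p826805/p827092; LAW C/Q/E/S/C⁺, first-moment subcubes, deletion identity,
normal form, LAW R, MOD_p / affine rectangle kills, saturated regime and its symmetry group); part I is the LAND-PACKAGE-6 delta (imports part H only).  Kernel-checked content:

* §16 **row labels are free** (NODE8): the factorisation of §14 is row-by-row Fourier inversion, so ROW-DEPENDENT non-constant tables
  `f_v` keep `rank [f_v(⟨v,w⟩)]_{v,w ∈ 𝔽_p^{r+1}} ≥ p^r` (`rank_satPatRow_ge`: one nonzero frequency per line representative makes the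
  line-block submatrix diagonal invertible; `rank_satPatRow_bilin_ge` adds the column-side affine label and change of pairing); game
  corollary `loss_of_rowTableSaturatedRectangle` (subsumes §14/§15's): every ROW-side label of the dense register — its own forms, its
  internal quadratic part, offsets, any function of the row subset — is absorbed into the table.
-/

open Finset
open Summit.QuantumAdvantage.AdviceFreeQNC0

namespace Summit.QuantumAdvantage.QuantumAdvantage.Theorems.InnerDegreeDial

/-! ### §16 ROW LABELS ARE FREE (NODE8 §3 (c0)(ix)): row-dependent tables keep the saturated bound

The factorisation `P = M · F` of §14 is row-by-row Fourier inversion, so it survives ROW-DEPENDENT tables `f_v`: the line-block matrix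
`M[v,u] = Σ_{s•v=u} f̂_v(s)` restricted to the line representatives `(1,a)` and ONE nonzero frequency `s(a)` chosen per row is DIAGONAL
invertible, hence `[f_v(⟨v,w⟩)]_{v,w ∈ 𝔽_p^{r+1}}` has rank `≥ p^r` as soon as every `f_v` is non-constant (`rank_satPatRow_ge`); the
column-side affine label and any non-degenerate change of pairing are absorbed by reindexing as in §15 (`rank_satPatRow_bilin_ge`).  Game
corollary `loss_of_rowTableSaturatedRectangle` (subsumes the corollaries of §14/§15): in the Σ-set criterion EVERY row-side label of the
dense register — its own linear forms, its internal quadratic part, offsets, any function of the row subset — is free; only column-side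
non-affine labels remain bookkeeping. -/

section RowTables

variable {K : Type*} [Field K] [CharP K 2]
variable {p : ℕ} [Fact p.Prime]

/-- the line-block matrix for ROW-DEPENDENT tables: `M[v,u] = Σ_{s : s•v = u} f̂_v(s)` -/
noncomputable def lineMatRow {ω : K} (hω : IsPrimitiveRoot ω p) {r : ℕ} (f : (Fin r → ZMod p) → ZMod p → K) :
    Matrix (Fin r → ZMod p) (Fin r → ZMod p) K :=
  Matrix.of fun v u => ∑ s : ZMod p, if s • v = u then fcoef hω (f v) s else 0

/-- pattern matrix with row-dependent tables: `[f_v(⟨v,w⟩)]_{v,w ∈ 𝔽_p^r}` -/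
def satPatRow {r : ℕ} (f : (Fin r → ZMod p) → ZMod p → K) : Matrix (Fin r → ZMod p) (Fin r → ZMod p) K :=
  Matrix.of fun v w => f v (v ⬝ᵥ w)

/-- the factorisation `P = M · F` survives row-dependent tables (Fourier inversion row by row) -/
theorem lineMatRow_mul_charMat (hp5 : 5 ≤ p) {ω : K} (hω : IsPrimitiveRoot ω p) {r : ℕ}
    (f : (Fin r → ZMod p) → ZMod p → K) : lineMatRow hω f * charMat hω r = satPatRow f := by
  classical
  ext v w
  rw [Matrix.mul_apply, satPatRow, Matrix.of_apply]
  have h1 : ∀ u, lineMatRow hω f v u * charMat hω r u w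
      = ∑ s, if s • v = u then fcoef hω (f v) s * Coset21.CharTwoKill.chi ω hω (u ⬝ᵥ w) else 0 := by
    intro u
    rw [lineMatRow, Matrix.of_apply, charMat, Matrix.of_apply, sum_mul]
    refine sum_congr rfl fun s _ => ?_
    split_ifs
    · rfl
    · rw [zero_mul]
  simp_rw [h1]
  rw [sum_comm]
  have h2 : ∀ s : ZMod p, ∑ u : Fin r → ZMod p, (if s • v = u then fcoef hω (f v) s * Coset21.CharTwoKill.chi ω hω (u ⬝ᵥ w) else 0)
      = fcoef hω (f v) s * Coset21.CharTwoKill.chi ω hω (s * (v ⬝ᵥ w)) := by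
    intro s
    rw [sum_ite_eq]
    simp only [mem_univ, if_true, smul_dotProduct, smul_eq_mul]
  simp_rw [h2]
  exact fourier_inv hp5 hω (f v) (v ⬝ᵥ w)

omit [CharP K 2] in
/-- on the line representatives `(1, a)` (rows) and `s(a) • (1, a)` (columns, one nonzero frequency chosen PER ROW) the row-dependent
line-block matrix is diagonal with entries `f̂_{(1,a)}(s(a))` -/
theorem lineMatRow_submatrix {ω : K} (hω : IsPrimitiveRoot ω p) {r : ℕ} (f : (Fin (r + 1) → ZMod p) → ZMod p → K)
    (s : (Fin r → ZMod p) → ZMod p) (hs : ∀ a, s a ≠ 0) :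
    (lineMatRow hω f).submatrix (lineRep p r) (fun a => s a • lineRep p r a)
      = Matrix.diagonal fun a => fcoef hω (f (lineRep p r a)) (s a) := by
  classical
  ext a a'
  rw [Matrix.submatrix_apply, lineMatRow, Matrix.of_apply, Matrix.diagonal_apply, sum_eq_single (s a')]
  · by_cases h : a = a'
    · subst h; simp
    · rw [if_neg h, if_neg]
      intro heq
      apply h
      have hinj : lineRep p r a = lineRep p r a' := smul_right_injective _ (hs a') heq
      funext i
      have := congrFun hinj i.succ
      simpa [lineRep] using this
  · intro s' _ hs'
    rw [if_neg]
    intro heq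
    apply hs'
    have := congrFun heq 0
    simpa [lineRep] using this
  · intro h
    exact absurd (mem_univ _) h

/-- **ROW LABELS ARE FREE (§16).**  For ROW-DEPENDENT tables `f_v : 𝔽_p → K`, each non-constant, the pattern
`[f_v(⟨v,w⟩)]_{v,w ∈ 𝔽_p^{r+1}}` still has rank `≥ p^r`: one nonzero Fourier frequency per line representative makes the
line-block submatrix diagonal invertible.  So in the Σ-set criterion every ROW-side label of the dense register (its own linear
forms, its internal quadratic part, its walk weight, any function of the row subset) is absorbed into the table. -/
theorem rank_satPatRow_ge (hp5 : 5 ≤ p) {ω : K} (hω : IsPrimitiveRoot ω p) {r : ℕ}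
    (f : (Fin (r + 1) → ZMod p) → ZMod p → K) (hf : ∀ v, ∃ a b, f v a ≠ f v b) :
    p ^ r ≤ (satPatRow f).rank := by
  classical
  have hch : ∀ a : Fin r → ZMod p, ∃ s₀ : ZMod p, s₀ ≠ 0 ∧ fcoef hω (f (lineRep p r a)) s₀ ≠ 0 := fun a => by
    obtain ⟨x, x', hxx'⟩ := hf (lineRep p r a)
    exact exists_fcoef_ne_zero hp5 hω _ hxx'
  choose s hs0 hsc using hch
  rw [← lineMatRow_mul_charMat hp5 hω f,
    Matrix.rank_mul_eq_left_of_isUnit_det _ _ (isUnit_charMat_det hp5 hω (r + 1))]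
  refine le_trans ?_ (Matrix.rank_submatrix_le (lineMatRow hω f) (lineRep p r) (fun a => s a • lineRep p r a))
  rw [lineMatRow_submatrix hω f s hs0]
  have hu : IsUnit (Matrix.diagonal fun a => fcoef hω (f (lineRep p r a)) (s a)) := by
    rw [Matrix.isUnit_iff_isUnit_det, Matrix.det_diagonal]
    exact isUnit_iff_ne_zero.mpr (prod_ne_zero_iff.mpr fun a _ => hsc a)
  rw [Matrix.rank_of_isUnit _ hu, Fintype.card_fun, ZMod.card, Fintype.card_fin]

/-- row-dependent tables under the symmetry group: a column-side affine label `⟨b,w⟩` and any non-degenerate change of pairing `N`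
are absorbed by reindexing (`v ↦ v − b·N'`, `w ↦ N'·w`), rank `≥ p^r` persists -/
theorem rank_satPatRow_bilin_ge (hp5 : 5 ≤ p) {ω : K} (hω : IsPrimitiveRoot ω p) {r : ℕ}
    (f : (Fin (r + 1) → ZMod p) → ZMod p → K) (hf : ∀ v, ∃ a b, f v a ≠ f v b)
    (b : Fin (r + 1) → ZMod p) (N N' : Matrix (Fin (r + 1)) (Fin (r + 1)) (ZMod p)) (hN : N * N' = 1) :
    p ^ r ≤ (Matrix.of fun v w : Fin (r + 1) → ZMod p => f v (v ⬝ᵥ N.mulVec w + b ⬝ᵥ w)).rank := by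
  classical
  have hsub : (Matrix.of fun v w : Fin (r + 1) → ZMod p => f v (v ⬝ᵥ N.mulVec w + b ⬝ᵥ w)).submatrix
      (fun v => v - Matrix.vecMul b N') (fun w => N'.mulVec w)
      = satPatRow (fun v => f (v - Matrix.vecMul b N')) := by
    ext v w
    rw [Matrix.submatrix_apply, Matrix.of_apply, satPatRow, Matrix.of_apply, Matrix.mulVec_mulVec, hN,
      Matrix.one_mulVec, Matrix.dotProduct_mulVec, ← add_dotProduct, sub_add_cancel]
  have h1 := rank_satPatRow_ge hp5 hω (fun v => f (v - Matrix.vecMul b N')) (fun v => hf _)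
  rw [← hsub] at h1
  exact h1.trans (Matrix.rank_submatrix_le _ _ _)

variable {n : ℕ}

/-- **THE ROW-TABLE SATURATED RECTANGLE KILL (§16; subsumes §14/§15's game corollaries).**  Registers `k`-form except `g₀`; `g₀` live on a
disjoint-support rectangle indexed by `v, w ∈ 𝔽_p^{r+1}` and firing as `G_v(⟨v, N w⟩ + ⟨b, w⟩)` with ROW-DEPENDENT non-constant tables `G_v`
(absorbing every row-side label: `g₀`'s own forms, its internal quadratic part, offsets) and any right-invertible `N`; then
`p^r > (n+1)·2p^k + 1` forces a losing input. -/
theorem loss_of_rowTableSaturatedRectangle (hp5 : 5 ≤ p) {k r : ℕ} (c : ℕ)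
    (y : Fin (n + 1) → (Fin n → Bool) → Bool) (g₀ : Fin (n + 1))
    (lam : Fin (n + 1) → Fin k → Fin n → ZMod p) (F : Fin (n + 1) → (Fin k → ZMod p) → Bool)
    (hF : ∀ g, g ≠ g₀ → ∀ u, y g u = F g (fun j => ∑ i, if u i = true then lam g j i else 0))
    (X Y : (Fin (r + 1) → ZMod p) → Fin n → Bool) (hd : ∀ v w l, ¬ (X v l = true ∧ Y w l = true))
    (G : (Fin (r + 1) → ZMod p) → ZMod p → Bool) (hG : ∀ v, ∃ b₁ b₂, G v b₁ ≠ G v b₂)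
    (b : Fin (r + 1) → ZMod p) (N N' : Matrix (Fin (r + 1)) (Fin (r + 1)) (ZMod p)) (hN : N * N' = 1)
    (hpat : ∀ v w, y g₀ (bor (X v) (Y w)) = G v (v ⬝ᵥ N.mulVec w + b ⬝ᵥ w))
    (hlive : ∀ v w, liveCut c (bor (X v) (Y w)) g₀ = true)
    (ht : (n + 1) * (p ^ k * 2) + 1 < p ^ r) :
    ∃ u, ringWinU c y u = false := by
  classical
  obtain ⟨hK, ω, -, hω, -⟩ := Coset21.exists_charTwo_roots p hp5
  haveI := hK
  refine loss_of_rectRank hp5 c y g₀ lam F hF X Y hd (lt_of_lt_of_le ht ?_)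
  have hrect : rect (Kp p) (fun u => y g₀ u && liveCut c u g₀) X Y
      = Matrix.of fun v w : Fin (r + 1) → ZMod p =>
          (fun v t => if G v t = true then (1 : Kp p) else 0) v (v ⬝ᵥ N.mulVec w + b ⬝ᵥ w) := by
    ext v w
    rw [rect, Matrix.of_apply, Matrix.of_apply]
    simp only [hpat v w, hlive v w, Bool.and_true]
  rw [hrect]
  refine rank_satPatRow_bilin_ge hp5 hω (fun v t => if G v t = true then (1 : Kp p) else 0) ?_ b N N' hN
  intro v
  obtain ⟨b₁, b₂, hb⟩ := hG v
  refine ⟨b₁, b₂, ?_⟩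
  intro h
  apply hb
  cases h1 : G v b₁ <;> cases h2 : G v b₂ <;> simp_all

end RowTables

end Summit.QuantumAdvantage.QuantumAdvantage.Theorems.InnerDegreeDial
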